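import Summits.QuantumFields.BalabanUV.Beta.FP.PerfectFullSandwich
import Summits.QuantumFields.BalabanUV.Beta.D1BFx.Assembly

/-!
# `BalabanUV.Beta.FP.PerfectRepBasePoint` — road «FP» for binder row D1, leaf N7 ∕ `hrep` (REP∞): THE PERFECT COEFFICIENT IN THE `_avg` END's
# BASE-POINT CURRENCY — for `W := vertex2OfK K n Wf`, `secondMoment (TPerfOf n K S W) μ ν = Σ_{b ∈ Bset n} wt n b · fullSum (w ↦ n⁻⁸·w_μ w_ν·𝓗(b+w, b))`
# with `Bset n = resSite '' [0,n)⁴`, `wt n b = n⁻⁴` (Σ wt = 1) and `𝓗 = fineHessA (Π K Π) (Πᵀ S) Wf μ ν` the FULL fine kernel — the junction of this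
# seat's K-R5 sandwich (`PerfectFullSandwich`) with road BF-x's A7 junction `D1BFx/Assembly.avgM2_eq_sum_fullSum` (d1-p2, p219112)

HONEST FRAMING (cell contract, verbatim): «discharging `BetaPertH` makes Bałaban's UV stability UNCONDITIONAL — a real
constructive-QFT result; it is NOT the continuum limit and NOT the Clay problem.»  [folklore] bookkeeping composed BY NAME: `PerfectFullSandwich.
secondMoment_TPerfOf_vertex2OfK_eq` ∕ `PerfectBubbleSandwich.secondMoment_bubblePart_TPerfOf_eq` (this seat) + `D1BFx/Assembly.avgM2_eq_sum_fullSum`,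
`sum_image_resSite`, `exists_tendsto_psum_weight_mul`, `uniform_resSite_nonneg`, `sum_uniform_resSite` (d1-p2) + `WindowIdentification.fullSum_const_mul`.
No definition, no `def … : Prop`, nothing cited, nothing of the manuscripts under audit asserted; the Ward rows `hrow` of the full fine kernel, `hT1`,
and the class ∕ covariance ∕ symmetry data of `S`, `Wf` stay HYPOTHESES; 0 estimates; 0∕4 binders of row D1.  Value: the shape of the `hrep` binder of
`FP/AsymptoticEndAvg.hasym_of_legInterface_avg` (`Σ_{b∈Bset n} wt n b · Σ_w w_μ w_ν (…)`, `hwt0`, `hwt1`) is met EXACTLY by the perfect kernel's second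
moment BEFORE the legs ∕ germs factorisation of `𝓗(b+w, b)` (REP-DESIGN rows LEGS ∕ GERM-K ∕ GERM-S ∕ TAILS — not here).  NOT `hrep`, NOT D1, NOT
BetaPertH, NOT continuum, NOT Clay.
HONEST DEPENDENCY (verbatim): continuum YM on T⁴ ⇐ BetaPertH ∧ nine spine estimates (0/9 proved); BetaPertH ⇐ (D1) ∧ (D4) ∧
CAP+tail; G-an2-4 gates asym, D1 and NE2/3/4.
-/

namespace Summit.QuantumFields.BalabanUV.Beta.FP.PerfectRepBasePoint

open Finset Filter Topology
open Literature.MathematicalPhysics.QuantumFieldTheory.Balaban1983to89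
open Literature.MathematicalPhysics.QuantumFieldTheory.Balaban1983to89.Beta
open ExpKernelCalculus (Site MKer Decays BiLoc shiftK)
open DecimatedMomentSummable (AbsMoment₂ ConstReproSum LinReproSum)
open DressedMomentNormalisation (resSite)
open WindowIdentification (fullSum fullSum_const_mul)
open DyadicShell (Pt toReal toReal_apply)
open OneStepResolventKernel (Fib LocStencil)
open AxialProjector (coProj)
open AxialDressing (axDressK decays_axDressK locStencil_coProj cN')
open SecondOrderResponse (vertex2OfK)
open Summit.QuantumFields.BalabanUV.Beta.TameKernelCalculus
open Summit.QuantumFields.BalabanUV.Beta.GAN24.CombesThomas (sfStep smStep)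
open Summit.QuantumFields.BalabanUV.Beta.D1BFx.MomentTransferPeriodic (Ker₂ baseKer)
open Summit.QuantumFields.BalabanUV.Beta.D1BFx.MomentTransferPeriodicEntry (avgM2)
open Summit.QuantumFields.BalabanUV.Beta.D1BFx.ReducedKernelSandwichLeg (fineHessA absMoment₂_baseKer_fineHessA)
open Summit.QuantumFields.BalabanUV.Beta.D1BFx.Assembly (avgM2_eq_sum_fullSum sum_image_resSite exists_tendsto_psum_weight_mul
  uniform_resSite_nonneg sum_uniform_resSite)
open Summit.QuantumFields.BalabanUV.Beta.FP.PerfectObjectsT (KPerf TPerfOf)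
open Summit.QuantumFields.BalabanUV.Beta.FP.TransportInfinityM (colOf)
open Summit.QuantumFields.BalabanUV.Beta.FP.StepLawKHolds (exists_decays_KPerf_holds)
open Summit.QuantumFields.BalabanUV.Beta.FP.SymmetryK (shiftK_KPerf)
open Summit.QuantumFields.BalabanUV.Beta.FP.PerfectBubbleSandwich (entryHyps_perfCol_zero)
open Summit.QuantumFields.BalabanUV.Beta.FP.PerfectFullSandwich (secondMoment_TPerfOf_vertex2OfK_eq)

noncomputable section

/-- [folklore] `n⁻⁸·avgM2 n Q` in the `_avg` END's currency at ONE blocking `n` (the fixed-`n` form of d1-p2's `Assembly.hF_of_avgM2`):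
`n⁻⁸·avgM2 n Q κ λ = Σ_{b ∈ resSite''} n⁻⁴ · fullSum (w ↦ n⁻⁸·(w_κ w_λ · Q (b+w) b))`. -/
theorem inv_mul_avgM2_eq_sum_fullSum {n : ℕ} (Q : Ker₂ 4) (hQ : ∀ r : Fin 4 → Fin n, AbsMoment₂ (baseKer Q (resSite r))) (κ lam : Fin 4) :
    ((n : ℝ) ^ 8)⁻¹ * avgM2 n Q κ lam
      = ∑ b ∈ (univ : Finset (Fin 4 → Fin n)).image resSite, ((n : ℝ) ^ 4)⁻¹ *
          fullSum (fun w : Pt => ((n : ℝ) ^ 8)⁻¹ * (toReal w κ * toReal w lam * baseKer Q b w)) := by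
  rw [avgM2_eq_sum_fullSum Q hQ κ lam, sum_image_resSite, mul_sum]
  refine sum_congr rfl fun r _ => ?_
  rw [fullSum_const_mul _ (exists_tendsto_psum_weight_mul (hQ r) κ lam)]
  ring

variable {n : ℕ} {K : MKer (3 + 1) (Fib 3)} {C δ : ℝ} {S : Fin (3 + 1) → (Fin (3 + 1) → ℤ) → MKer (3 + 1) (Fib 3)} {Cs δs : ℝ}
  {Wf : Fin (3 + 1) → (Fin (3 + 1) → ℤ) → Fin (3 + 1) → (Fin (3 + 1) → ℤ) → MKer (3 + 1) (Fib 3)} {C2 δ2 : ℝ}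

/-- [folklore] **THE (1.22) SECOND MOMENT OF THE WHOLE PERFECT KERNEL (bi-vertex second-order slot) IN BASE-POINT CURRENCY**:
`secondMoment (TPerfOf n K S (vertex2OfK K n Wf)) μ ν = Σ_{b ∈ resSite''} n⁻⁴ · fullSum (w ↦ n⁻⁸·w_μ w_ν·fineHessA (Π K Π) (Πᵀ S) Wf μ ν (b+w) b)`
under the hypotheses of `PerfectFullSandwich.secondMoment_TPerfOf_vertex2OfK_eq` (K-side letters, `S`∕`Wf` class + coarse covariance + symmetry,
Ward rows `hrow` of the FULL fine kernel, `hT1`). -/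
theorem secondMoment_TPerfOf_vertex2OfK_eq_basePoint (hn : 1 ≤ n) (hK : Decays K C δ) (hδ : 0 < δ)
    (hKcov : ∀ t : Fin (3 + 1) → ℤ, shiftK (-((n : ℤ) • t)) K = K)
    (hw0 : ∀ κ l : Fin 4, ConstReproSum n (colOf K κ l) (if κ = l then (((n : ℝ) ^ (4 + 1))⁻¹) else 0))
    (hw1 : ∀ κ l : Fin 4, ∃ C : Fin 4 → ℝ, LinReproSum n (colOf K κ l) C) (hwA : ∀ κ l : Fin 4, AbsMoment₂ (colOf K κ l))
    (hS : LocStencil S Cs δs) (hδs : 0 < δs) (hScov : ∀ κ u t, S κ (u + (n : ℤ) • t) = shiftK (-((n : ℤ) • t)) (S κ u))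
    (hW : ∀ κ' u l' u', BiLoc (Wf κ' u l' u') u u' C2 δ2) (hδ2 : 0 < δ2)
    (hWcov : ∀ κ' u l' u' t, Wf κ' (u + (n : ℤ) • t) l' (u' + (n : ℤ) • t) = shiftK (-((n : ℤ) • t)) (Wf κ' u l' u'))
    (hWsymm : ∀ (κ' : Fin 4) (u : Site 4) (l' : Fin 4) (u' : Site 4), Wf κ' u l' u' = Wf l' u' κ' u)
    (hrow : ∀ (κ' l' : Fin 4) (b : Site 4), HasSum (fineHessA (axDressK n K) (coProj n S) Wf κ' l' b) 0)
    (hT1 : ∀ (κ' l' μ' : Fin 4), ∑ r : Fin 4 → Fin n, ∑' t, (t μ' : ℝ) *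
      baseKer (fineHessA (axDressK n K) (coProj n S) Wf κ' l') (resSite r) t = 0)
    (μ ν : Fin 4) :
    B12Beta.secondMoment (TPerfOf n K S (vertex2OfK K n Wf)) μ ν
      = ∑ b ∈ (univ : Finset (Fin 4 → Fin n)).image resSite, ((n : ℝ) ^ 4)⁻¹ *
          fullSum (fun w : Pt => ((n : ℝ) ^ 8)⁻¹ *
            (toReal w μ * toReal w ν * baseKer (fineHessA (axDressK n K) (coProj n S) Wf μ ν) b w)) := by
  have hA : Spr (axDressK n K) := ⟨_, δ, hδ, decays_axDressK hn hK hδ.le⟩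
  have hm : 0 < min δs δ2 := lt_min hδs hδ2
  have hS' : ∀ κ u, BiLoc (coProj n S κ u) u u (|cN' 3 n δs * Cs|) (min δs δ2) := fun κ u =>
    biLoc_of_le (locStencil_coProj hn hS hδs.le κ u) (min_le_left _ _)
  have hW' : ∀ κ' u l' u', BiLoc (Wf κ' u l' u') u u' (|C2|) (min δs δ2) := fun κ' u l' u' =>
    biLoc_of_le (hW κ' u l' u') (min_le_right _ _)
  unfold B12Beta.secondMoment
  rw [secondMoment_TPerfOf_vertex2OfK_eq hn hK hδ hKcov hw0 hw1 hwA hS hδs hScov hW hδ2 hWcov hWsymm hrow hT1 μ ν μ ν]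
  exact inv_mul_avgM2_eq_sum_fullSum _ (fun r => absMoment₂_baseKer_fineHessA (axDressK n K) hA hS' hW' hm μ ν (resSite r)) μ ν

/-- [folklore] The weights of that representation are the `_avg` END's: nonnegative and summing to `1` (`Assembly.uniform_resSite_nonneg`,
`Assembly.sum_uniform_resSite`, restated at the pair `(Bset, wt) := (resSite '', n⁻⁴)` for the consumer). -/
theorem basePoint_weights (hn : 1 ≤ n) :
    (∀ b ∈ (univ : Finset (Fin 4 → Fin n)).image resSite, (0 : ℝ) ≤ ((n : ℝ) ^ 4)⁻¹)
      ∧ ∑ _b ∈ (univ : Finset (Fin 4 → Fin n)).image (resSite (d := 4) (N := n)), ((n : ℝ) ^ 4)⁻¹ = 1 :=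
  ⟨fun b hb => uniform_resSite_nonneg n b hb, sum_uniform_resSite (by omega)⟩

section Perfect

variable {Lc : ℕ} [NeZero Lc]

/-- [folklore] **THE PERFECT COEFFICIENT's SHAPE IN THE `_avg` END's CURRENCY, K-SIDE HYPOTHESIS-FREE** (`K := KPerf Lc (sfStep Lc) (smStep 3 Lc) m`,
`n := Lc^m`, `2 ≤ Lc`, `1 ≤ m`): for `W := vertex2OfK K n Wf`,
`secondMoment (TPerfOf n K S W) μ ν = Σ_{b ∈ resSite''} n⁻⁴ · fullSum (w ↦ n⁻⁸·w_μ w_ν·fineHessA (Π K Π) (Πᵀ S) Wf μ ν (b+w) b)`. -/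
theorem secondMoment_TPerfOf_perfect_eq_basePoint (hLc : 2 ≤ Lc) {m : ℕ} (hm : 1 ≤ m)
    {S : Fin (3 + 1) → (Fin (3 + 1) → ℤ) → MKer (3 + 1) (Fib 3)} {Cs δs : ℝ} (hS : LocStencil S Cs δs) (hδs : 0 < δs)
    (hScov : ∀ κ u t, S κ (u + ((Lc ^ m : ℕ) : ℤ) • t) = shiftK (-(((Lc ^ m : ℕ) : ℤ) • t)) (S κ u))
    {Wf : Fin (3 + 1) → (Fin (3 + 1) → ℤ) → Fin (3 + 1) → (Fin (3 + 1) → ℤ) → MKer (3 + 1) (Fib 3)} {C2 δ2 : ℝ}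
    (hW : ∀ κ' u l' u', BiLoc (Wf κ' u l' u') u u' C2 δ2) (hδ2 : 0 < δ2)
    (hWcov : ∀ κ' u l' u' t, Wf κ' (u + ((Lc ^ m : ℕ) : ℤ) • t) l' (u' + ((Lc ^ m : ℕ) : ℤ) • t)
      = shiftK (-(((Lc ^ m : ℕ) : ℤ) • t)) (Wf κ' u l' u'))
    (hWsymm : ∀ (κ' : Fin 4) (u : Site 4) (l' : Fin 4) (u' : Site 4), Wf κ' u l' u' = Wf l' u' κ' u)
    (hrow : ∀ (κ' l' : Fin 4) (b : Site 4),
      HasSum (fineHessA (axDressK (Lc ^ m) (KPerf (d := 3) Lc (sfStep Lc) (smStep 3 Lc) m)) (coProj (Lc ^ m) S) Wf κ' l' b) 0)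
    (hT1 : ∀ (κ' l' μ' : Fin 4), ∑ r : Fin 4 → Fin (Lc ^ m), ∑' t, (t μ' : ℝ) *
      baseKer (fineHessA (axDressK (Lc ^ m) (KPerf (d := 3) Lc (sfStep Lc) (smStep 3 Lc) m)) (coProj (Lc ^ m) S) Wf κ' l')
        (resSite r) t = 0)
    (μ ν : Fin 4) :
    B12Beta.secondMoment (TPerfOf (Lc ^ m) (KPerf (d := 3) Lc (sfStep Lc) (smStep 3 Lc) m) S
        (vertex2OfK (KPerf (d := 3) Lc (sfStep Lc) (smStep 3 Lc) m) (Lc ^ m) Wf)) μ ν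
      = ∑ b ∈ (univ : Finset (Fin 4 → Fin (Lc ^ m))).image resSite, ((((Lc ^ m : ℕ) : ℝ)) ^ 4)⁻¹ *
          fullSum (fun w : Pt => ((((Lc ^ m : ℕ) : ℝ)) ^ 8)⁻¹ * (toReal w μ * toReal w ν *
            baseKer (fineHessA (axDressK (Lc ^ m) (KPerf (d := 3) Lc (sfStep Lc) (smStep 3 Lc) m)) (coProj (Lc ^ m) S) Wf μ ν) b w)) := by
  have hn : 1 ≤ Lc ^ m := Nat.one_le_pow _ _ (by omega)
  obtain ⟨CK, δK, hδK, hK⟩ := exists_decays_KPerf_holds hLc hm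
  have hE := entryHyps_perfCol_zero hLc hm
  have h := secondMoment_TPerfOf_vertex2OfK_eq_basePoint (n := Lc ^ m) hn hK hδK
    (fun t => shiftK_KPerf Lc (sfStep Lc) (smStep 3 Lc) m t) hE.const hE.lin hE.absW hS hδs (by exact_mod_cast hScov) hW hδ2
    (by exact_mod_cast hWcov) hWsymm hrow hT1 μ ν
  simpa using h

end Perfect

end

end Summit.QuantumFields.BalabanUV.Beta.FP.PerfectRepBasePoint
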